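import Literature.NumberTheory.EllipticCurves.IsogenyMultiplierXFormulaProofs
import Literature.NumberTheory.EllipticCurves.IsogenyRealPeriodProofs
import Literature.NumberTheory.EllipticCurves.IsogenyRationalPointsBaseChangeProofs
import Literature.NumberTheory.EllipticCurves.NeronIsogenyScalingHoldsProofs
import Literature.NumberTheory.EllipticCurves.Rank1Residual.GVParityTransferProofs
import Literature.NumberTheory.EllipticCurves.BSDInvariants
import HarnessLib

/-!
# The real period along an isogeny with ODD kernel: `Ω(E') = |k|·Ω(E)` for the analytic
# multiplier `k` (cell `b2b-bsdres`, unit `b2b-bsdres-eisenstein-p2`, gen 28)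

HONEST FRAMING (run/shared/lean/b2b/bsd-rank1-residual/, verbatim in every file): the goal of the
cell is to DELETE the COMBINATION-SHAPED residual classes of the Birch–Swinnerton-Dyer formula for
ALL analytic-rank `≤ 1` elliptic curves over `ℚ` — "full BSD formula for every rank `≤ 1` curve in
class `C`" assembled STRICTLY from published theorems — so that the rank-`≤ 1` remainder becomes
exactly the CONSTRUCTION-SHAPED classes, which are TYPED (missing-input `Prop`s), NOT attempted.
This is not "finishing BSD". Research route; NO CLAIM BEYOND STATED CLASSES; nothing here changes
a label. Theorems only; no definition, no named fact.

WHY. The ARCHIMEDEAN half of the kernel derivation of Greenberg–Vatsal's period clause Cor. (3.8)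
(registered fact A180 `GreenbergVatsal2000.cor38_realPeriodRat_eq_unit_mul_of_isIsogenous_of_gvPar`,
binder `hP` of the X2a closure term), for the isogeny the consumers use: `ψ : E → E'` over `ℚ` with
kernel a rational `p`-line `Φ₀` (`p` odd) that is ODD (complex conjugation acts by `−1`).  Milne's
archimedean local factor (tree
`WeierstrassCurve.Isogeny.exists_algebraMap_card_ker_inf_realPoints_mul_realPeriod_eq`, *ADT*
I.7.2/I.7.3 at `v = ∞`) reads `#ker(ψ_ℂ|E(ℝ)) · Ω(E') = [E'(ℝ) : ψ_ℂ E(ℝ)] · |k| · Ω(E)` for the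
analytic multiplier `k ∈ ℚˣ` (`ψ_ℂ(u z) = u'(kz)`, `kΛ ⊆ Λ'`).  Here:

* §1 `natCard_ker_inf_range_eq_one_of_lineOdd` — **`#ker(ψ_ℂ|E(ℝ)) = 1`**: a real point of the
  kernel is `j_* P`, `P ∈ Φ₀`, fixed by the complex conjugation `c ∈ Γ_ℚ` attached to the embedding
  `j : ℚ̄ → ℂ` (`AlgHom.restrictNormal'`; `geomPoints.map_map_toAlgHom`), while `cP = −P` (odd) and
  `2P = 0 ⇒ P = 0` for `p` odd;
* §2 `relIndex_map_range_eq_one` — **`[E'(ℝ) : ψ_ℂ E(ℝ)] = 1`**: with `E(ℝ) = u(R)`,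
  `R = {z | z̄ − z ∈ Λ}` (tree `range_map_eq_map_realLocus_of_uniformization`) and
  `p·k⁻¹Λ' ⊆ Λ` (`[k⁻¹Λ' : Λ] = #ker ψ = p`), every `z' ∈ R'` is `k z` modulo `Λ'` for
  `z = k⁻¹z' + m ν ∈ R`, `ν = \overline{k⁻¹z'} − k⁻¹z'`, `2m = p + 1` (then
  `z̄ − z = (1 − 2m)ν = −pν ∈ Λ`);
* §3 **`exists_multiplier_of_lineOdd`** — hence **`Ω(E') = |k| · Ω(E)`**, packaged with the
  `x`-coordinate formula `x(ψP) = A(x)/B(x)`, `lc A = k⁻²` (tree, gen 28,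
  `Isogeny.exists_x_formula_of_baseChange_apply_eq`) and the INTEGRALITY `k ∈ ℤ` when both models
  are globally minimal (tree `integral_neronScaling_of_isGloballyMinimal_holds`) — the data from
  which the `p`-adic half (`X2/IsogenyPeriodRatio`) proves `|k|_p = 1`.

References: [MilneADT2006] Ch. I §7 (Lemma 7.2, proof of Thm. 7.3); [SilvermanAEC2009]
Thm. VI.4.1(b), III.5; [SilvermanATAEC1994] V.2 (`E(ℝ)`); [DokchitserLocalInvariants2015]
(T. & V. Dokchitser, *Local invariants of isogenous elliptic curves*, Trans. AMS 367 (2015), Thm. 2: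
`Ω(E,ω)/Ω(E',ω') = λ|ω/φ^*ω'|`, `λ = 1` for `ker φ ⊄ E(ℝ)`, `p ≠ 2` — the statement proved here in
the tree's vocabulary); [GreenbergVatsal2000] §3 Cor. (3.8) (the consumer);
HOME/b2b-bsdres-eisenstein-p2/X2-GAP.md §33.
-/

set_option autoImplicit false

noncomputable section

open scoped Classical ComplexConjugate

open WeierstrassCurve Polynomial Field Complex
  Literature.NumberTheory.EllipticCurves Literature.NumberTheory.EllipticCurves.Rank1Residual
  Literature.NumberTheory.GaloisRepresentations _root_.PeriodPair

namespace Summit.BirchSwinnertonDyer.Rank1Residual.X2.IsogenyKernelRealPoints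

section Analytic

variable [Algebra (AlgebraicClosure ℚ) ℂ] [IsScalarTower ℚ (AlgebraicClosure ℚ) ℂ]
variable {W W' : WeierstrassCurve ℚ} [W.IsElliptic] [W'.IsElliptic] {p : ℕ} [hp : Fact p.Prime]

/-! ## §1. An odd kernel has no real point but `O` -/

omit [Algebra (AlgebraicClosure ℚ) ℂ] [IsScalarTower ℚ (AlgebraicClosure ℚ) ℂ] [W.IsElliptic]
  [W'.IsElliptic] hp in
/-- A real point of `E(ℂ)` (one in the image of `(E ⊗ ℝ)(ℝ)`) is fixed by coordinatewise complex
conjugation. [folklore] -/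
private theorem map_conj_eq_of_mem_range (σc : ℂ →ₐ[ℚ] ℂ) (hσc : ∀ z, σc z = conj z)
    {R : (W.baseChange ℂ).toAffine.Point}
    (hR : R ∈ (Affine.Point.map (W' := W) (IsScalarTower.toAlgHom ℚ ℝ ℂ)).range) :
    Affine.Point.map (W' := W) σc R = R := by
  obtain ⟨Q, rfl⟩ := hR
  have hιapp : ∀ s : ℝ, IsScalarTower.toAlgHom ℚ ℝ ℂ s = (s : ℂ) := fun s ↦ rfl
  rcases Q with _ | ⟨s, t, hst⟩
  · rfl
  · rw [Affine.Point.map_some, Affine.Point.map_some, Affine.Point.some.injEq, hιapp, hιapp,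
      hσc, hσc, Complex.conj_ofReal, Complex.conj_ofReal]
    exact ⟨rfl, rfl⟩

omit [W.IsElliptic] [W'.IsElliptic] hp in
/-- **The complex conjugation of `Γ_ℚ` attached to the embedding `ℚ̄ → ℂ`**: there is `c ∈ Γ_ℚ` with
`\overline{j(x)} = j(c x)` for all `x ∈ ℚ̄` (restriction of conjugation to the normal extension
`ℚ̄/ℚ`, `AlgHom.restrictNormal'`), and `c` is a complex conjugation for the real place of `ℚ`
(`IsComplexConjugation (Rat.castHom ℝ) c`). [folklore] -/
theorem exists_conj_restrict (σc : ℂ →ₐ[ℚ] ℂ) (hσc : ∀ z, σc z = conj z) :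
    ∃ c : absoluteGaloisGroup ℚ,
      (∀ x : AlgebraicClosure ℚ, σc (algebraMap (AlgebraicClosure ℚ) ℂ x) =
        algebraMap (AlgebraicClosure ℚ) ℂ (absoluteGaloisGroup.toAlgEquiv ℚ c x)) ∧
      IsComplexConjugation (Rat.castHom ℝ) c := by
  haveI : Algebra.IsAlgebraic ℚ (AlgebraicClosure ℚ) := AlgebraicClosure.isAlgebraic ℚ
  haveI : Normal ℚ (AlgebraicClosure ℚ) :=
    @IsAlgClosure.normal ℚ (AlgebraicClosure ℚ) _ _ (AlgebraicClosure.instAlgebra ℚ) inferInstance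
  set χ : AlgebraicClosure ℚ →ₐ[ℚ] ℂ :=
    σc.comp (IsScalarTower.toAlgHom ℚ (AlgebraicClosure ℚ) ℂ) with hχ
  set τ₀ : AlgebraicClosure ℚ ≃ₐ[ℚ] AlgebraicClosure ℚ :=
    AlgHom.restrictNormal' χ (AlgebraicClosure ℚ) with hτ₀
  set c : absoluteGaloisGroup ℚ := (absoluteGaloisGroup.toAlgEquiv ℚ).symm τ₀ with hc
  have hf : ∀ x : AlgebraicClosure ℚ, σc (algebraMap (AlgebraicClosure ℚ) ℂ x) =
      algebraMap (AlgebraicClosure ℚ) ℂ (absoluteGaloisGroup.toAlgEquiv ℚ c x) := by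
    intro x
    have h2 := AlgHom.restrictNormal_commutes χ (AlgebraicClosure ℚ) x
    calc σc (algebraMap (AlgebraicClosure ℚ) ℂ x)
        = χ (algebraMap (AlgebraicClosure ℚ) (AlgebraicClosure ℚ) x) := rfl
      _ = algebraMap (AlgebraicClosure ℚ) ℂ (χ.restrictNormal (AlgebraicClosure ℚ) x) := h2.symm
      _ = algebraMap (AlgebraicClosure ℚ) ℂ (absoluteGaloisGroup.toAlgEquiv ℚ c x) := rfl
  refine ⟨c, hf, ?_⟩
  rw [isComplexConjugation_iff]
  refine ⟨(algebraMap (AlgebraicClosure ℚ) ℂ : AlgebraicClosure ℚ →+* ℂ), Subsingleton.elim _ _,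
    fun x ↦ ?_⟩
  rw [Field.absoluteGaloisGroup.smul_def, ← hf, hσc]

omit [W.IsElliptic] [W'.IsElliptic] in
/-- **`#ker(ψ_ℂ|E(ℝ)) = 1` for an isogeny whose kernel is an ODD rational `p`-line** (`p` odd):
the only real point of `E(ℂ)` in the kernel of `ψ_ℂ` is `O`.  A point of `ker ψ_ℂ` is `j_* P`
with `ψ P = O` (`Isogeny.ker_baseChange_eq_map`), i.e. `P ∈ Φ₀`; if it is real it is fixed by
conjugation, so `cP = P` for the complex conjugation `c ∈ Γ_ℚ` of `exists_conj_restrict`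
(`geomPoints.map_map_toAlgHom`), while `cP = −P` (`Φ₀` odd): `2P = 0`, `P = 0` (`p` odd).
(Dokchitser–Dokchitser 2015, Thm. 2: `λ = 1` when `ker φ ⊄ E(ℝ)`.) [folklore] -/
theorem natCard_ker_inf_range_eq_one_of_lineOdd (hp2 : p ≠ 2) (ψ : Isogeny W W')
    {Φ₀ : AddSubgroup (geomTorsion W (p : ℤ))}
    (hker : ψ.toAddMonoidHom.ker = Φ₀.map (geomTorsion W (p : ℤ)).subtype)
    (hodd : LineOdd W p Φ₀) :
    Nat.card ↥((ψ.baseChange (M := ℂ)).ker ⊓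
      (Affine.Point.map (W' := W) (IsScalarTower.toAlgHom ℚ ℝ ℂ)).range) = 1 := by
  rw [AddSubgroup.card_eq_one, eq_bot_iff]
  intro R hR
  rw [AddSubgroup.mem_inf] at hR
  obtain ⟨hRker, hRreal⟩ := hR
  rw [ψ.ker_baseChange_eq_map, AddSubgroup.mem_map] at hRker
  obtain ⟨s, hs, rfl⟩ := hRker
  -- `s ∈ Φ₀`
  have hs' : s ∈ Φ₀.map (geomTorsion W (p : ℤ)).subtype := by rw [← hker]; exact hs
  obtain ⟨P, hP, rfl⟩ := hs'
  -- complex conjugation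
  obtain ⟨σc, hσc⟩ := exists_algHom_conj (K := ℚ) conj_algebraMap
  obtain ⟨c, hf, hcc⟩ := exists_conj_restrict σc hσc
  have hfix := map_conj_eq_of_mem_range (W := W) σc hσc hRreal
  rw [geomPoints.map_map_toAlgHom σc c hf] at hfix
  have hfix' : c • ((geomTorsion W (p : ℤ)).subtype P) = (geomTorsion W (p : ℤ)).subtype P :=
    Affine.Point.map_injective _ hfix
  -- `cP = -P` and `cP = P` force `P = 0`
  have hneg : c • P = -P := hodd c hcc P hP
  have hPP : P + P = 0 := by
    have h1 : ((c • P : geomTorsion W (p : ℤ)) : W.geomPoints) = (P : W.geomPoints) := hfix'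
    rw [hneg] at h1
    have h2 : -P = P := Subtype.ext h1
    nth_rewrite 1 [← h2]
    exact neg_add_cancel P
  have hP0 : P = 0 := eq_zero_of_add_self_eq_zero hp2 hPP
  rw [hP0, map_zero, AddSubgroup.mem_bot]
  exact map_zero _

/-! ## §2. The image of the real points has index one -/

omit [W.IsElliptic] [W'.IsElliptic] in
/-- **`[E'(ℝ) : ψ_ℂ E(ℝ)] = 1` for an isogeny of odd prime degree `p`**, from the analytic data
(Néron-type lattices `Λ, Λ'`, uniformisations `u, u'`, multiplier `k`: `ψ_ℂ(u z) = u'(kz)`,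
`kΛ ⊆ Λ'`) and `#ker ψ = p`: `E(ℝ) = u(R)`, `R = {z | z̄ − z ∈ Λ}` (likewise for `E'`), `[k⁻¹Λ' : Λ]
= #ker ψ_ℂ = p` so `p·k⁻¹Λ' ⊆ Λ`, and for `z' ∈ R'` the point `z = k⁻¹z' + mν`,
`ν = \overline{k⁻¹z'} − k⁻¹z'`, `2m = p + 1`, lies in `R` (`z̄ − z = (1 − 2m)ν = −pν ∈ Λ`) with
`kz ≡ z' (mod Λ')`. [folklore] -/
theorem relIndex_map_range_eq_one (hp2 : p ≠ 2) (ψ : Isogeny W W') {L L' : PeriodPair}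
    (h₂ : L.g₂ = (W.baseChange ℂ).c₄ / 12) (h₃ : L.g₃ = (W.baseChange ℂ).c₆ / 216)
    (h₂' : L'.g₂ = (W'.baseChange ℂ).c₄ / 12) (h₃' : L'.g₃ = (W'.baseChange ℂ).c₆ / 216)
    {u : ℂ →+ (W.baseChange ℂ).toAffine.Point} (hkeru : (u.ker : Set ℂ) = L.lattice)
    (hsurj : Function.Surjective u)
    (hu : ∀ z ∉ L.lattice, ∃ hz, u z = .some (℘[L] z - (W.baseChange ℂ).b₂ / 12)
        ((℘'[L] z - (W.baseChange ℂ).a₁ * (℘[L] z - (W.baseChange ℂ).b₂ / 12) -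
          (W.baseChange ℂ).a₃) / 2) hz)
    {u' : ℂ →+ (W'.baseChange ℂ).toAffine.Point} (hkeru' : (u'.ker : Set ℂ) = L'.lattice)
    (hsurj' : Function.Surjective u')
    (hu' : ∀ z ∉ L'.lattice, ∃ hz, u' z = .some (℘[L'] z - (W'.baseChange ℂ).b₂ / 12)
        ((℘'[L'] z - (W'.baseChange ℂ).a₁ * (℘[L'] z - (W'.baseChange ℂ).b₂ / 12) -
          (W'.baseChange ℂ).a₃) / 2) hz)
    {k : ℚ} (hk : k ≠ 0) (happ : ∀ z, ψ.baseChange (u z) = u' (algebraMap ℚ ℂ k * z))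
    (hcard : Nat.card ψ.toAddMonoidHom.ker = p) :
    AddSubgroup.relIndex
      (((Affine.Point.map (W' := W) (IsScalarTower.toAlgHom ℚ ℝ ℂ)).range).map
        (ψ.baseChange (M := ℂ)))
      ((Affine.Point.map (W' := W') (IsScalarTower.toAlgHom ℚ ℝ ℂ)).range) = 1 := by
  have hpP : p.Prime := hp.out
  have hkC' : algebraMap ℚ ℂ k = (k : ℂ) := eq_ratCast _ k
  have hkC : (k : ℂ) ≠ 0 := by exact_mod_cast hk
  have hu0 : ∀ w, u w = 0 ↔ w ∈ L.lattice := fun w ↦ by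
    rw [← SetLike.mem_coe, ← hkeru, SetLike.mem_coe, AddMonoidHom.mem_ker]
  have hu'0 : ∀ w, u' w = 0 ↔ w ∈ L'.lattice := fun w ↦ by
    rw [← SetLike.mem_coe, ← hkeru', SetLike.mem_coe, AddMonoidHom.mem_ker]
  -- the real loci
  set R : AddSubgroup ℂ := L.lattice.toAddSubgroup.comap
    ((starRingEnd ℂ : ℂ →+* ℂ).toAddMonoidHom - AddMonoidHom.id ℂ) with hRdef
  have hR : ∀ z, z ∈ R ↔ conj z - z ∈ L.lattice := fun z ↦ Iff.rfl
  set R' : AddSubgroup ℂ := L'.lattice.toAddSubgroup.comap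
    ((starRingEnd ℂ : ℂ →+* ℂ).toAddMonoidHom - AddMonoidHom.id ℂ) with hR'def
  have hR' : ∀ z, z ∈ R' ↔ conj z - z ∈ L'.lattice := fun z ↦ Iff.rfl
  have hreal := range_map_eq_map_realLocus_of_uniformization h₂ h₃ u hkeru hu hsurj hR
  have hreal' := range_map_eq_map_realLocus_of_uniformization h₂' h₃' u' hkeru' hu' hsurj' hR'
  -- `T = {z | kz ∈ Λ'}` has `[T : Λ] = #ker ψ = p`, so `pT ⊆ Λ`
  set K : AddSubgroup (W.baseChange ℂ).toAffine.Point := (ψ.baseChange (M := ℂ)).ker with hKdef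
  have hKcard : Nat.card K = p := by
    rw [hKdef, ψ.ker_baseChange_eq_map, ← hcard]
    exact (Nat.card_congr (ψ.toAddMonoidHom.ker.equivMapOfInjective _
      (Affine.Point.map_injective _)).toEquiv).symm
  set T : AddSubgroup ℂ := K.comap u with hTdef
  have hT : ∀ z, z ∈ T ↔ (k : ℂ) * z ∈ L'.lattice := fun z ↦ by
    rw [hTdef, AddSubgroup.mem_comap, hKdef, AddMonoidHom.mem_ker, happ, hkC', hu'0]
  have hidx : u.ker.relIndex T = p := by
    rw [← AddMonoidHom.comap_bot, hTdef, AddSubgroup.relIndex_comap, AddSubgroup.relIndex_bot_left,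
      AddSubgroup.map_comap_eq_self_of_surjective hsurj, hKcard]
  have hpT : ∀ z ∈ T, (p : ℂ) * z ∈ L.lattice := by
    intro z hz
    have h := AddSubgroup.nsmul_relIndex_mem u.ker (K := T) hz
    rw [hidx, AddMonoidHom.mem_ker, hu0, nsmul_eq_mul] at h
    exact h
  -- `m` with `2m = p + 1`
  obtain ⟨m, hm⟩ := hpP.odd_of_ne_two hp2
  -- every real point of `E'` is `ψ_ℂ` of a real point of `E`
  rw [AddSubgroup.relIndex_eq_one]
  intro P' hP'
  rw [hreal'] at hP'
  obtain ⟨z', hz'R, rfl⟩ := hP'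
  rw [SetLike.mem_coe, hR'] at hz'R
  obtain ⟨ν, hν⟩ : ∃ ν : ℂ, ν = conj ((k : ℂ)⁻¹ * z') - (k : ℂ)⁻¹ * z' := ⟨_, rfl⟩
  have hkν : (k : ℂ) * ν = conj z' - z' := by
    rw [hν, map_mul, map_inv₀, map_ratCast, mul_sub, mul_inv_cancel_left₀ hkC,
      mul_inv_cancel_left₀ hkC]
  have hνT : ν ∈ T := by rw [hT, hkν]; exact hz'R
  have hconjν : conj ν = -ν := by rw [hν, map_sub, Complex.conj_conj]; ring
  have hconj₀ : conj ((k : ℂ)⁻¹ * z') = ν + (k : ℂ)⁻¹ * z' := by rw [hν]; ring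
  have hpC : (p : ℂ) = 2 * (m : ℂ) + 1 := by rw [hm]; push_cast; ring
  obtain ⟨z, hzdef⟩ : ∃ z : ℂ, z = (k : ℂ)⁻¹ * z' + ((m + 1 : ℕ) : ℂ) * ν := ⟨_, rfl⟩
  have hzR : z ∈ R := by
    rw [hR]
    have hcalc : conj z - z = -((p : ℂ) * ν) := by
      rw [hzdef, map_add, hconj₀, map_mul, map_natCast, hconjν, hpC]
      push_cast
      ring
    rw [hcalc]
    exact neg_mem (hpT ν hνT)
  have hkz : (k : ℂ) * z = z' + ((m + 1 : ℕ) : ℂ) * ((k : ℂ) * ν) := by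
    rw [hzdef, mul_add, mul_inv_cancel_left₀ hkC]; ring
  have hmem : ((m + 1 : ℕ) : ℂ) * ((k : ℂ) * ν) ∈ L'.lattice := by
    rw [← nsmul_eq_mul]
    exact L'.lattice.toAddSubgroup.nsmul_mem (by rw [hkν]; exact hz'R) _
  refine ⟨u z, ?_, ?_⟩
  · rw [hreal]
    exact ⟨z, hzR, rfl⟩
  · rw [happ, hkC', hkz, map_add, (hu'0 _).mpr hmem, add_zero]

/-! ## §3. `Ω(E') = |k| Ω(E)`, the `x`-formula and the integrality of `k` -/

/-- **The multiplier of an isogeny with odd `p`-line kernel controls the real periods exactly.**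
For an isogeny `ψ : E → E'` over `ℚ` (both elliptic) whose kernel is a rational `p`-line `Φ₀`
(`p` odd) that is ODD, there is `k ∈ ℚˣ` (the analytic multiplier) with
(i) `Ω(E') = |k| · Ω(E)` for the real periods `realPeriodRat` of the two models (Milne's
archimedean factor with `#ker(ψ_ℂ|E(ℝ)) = 1`, §1, and index `1`, §2);
(ii) `x(ψP) = A(x)/B(x)` off `ker ψ` with `A, B ∈ ℚ[X]`, `B` monic, `deg A = deg B + 1`,
`lc A = k⁻²` (`Isogeny.exists_x_formula_of_baseChange_apply_eq`);
(iii) `k ∈ ℤ` if both models are globally minimal (Néron integrality, tree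
`integral_neronScaling_of_isGloballyMinimal_holds`).
[cite: MilneADT2006, Ch. I §7, proof of Thm. 7.3, p. 98] [cite: SilvermanAEC2009, Thm. VI.4.1(b)] -/
theorem exists_multiplier_of_lineOdd_aux (hp2 : p ≠ 2) (ψ : Isogeny W W')
    {Φ₀ : AddSubgroup (geomTorsion W (p : ℤ))} (hΦ : IsRationalLine W p Φ₀)
    (hker : ψ.toAddMonoidHom.ker = Φ₀.map (geomTorsion W (p : ℤ)).subtype)
    (hodd : LineOdd W p Φ₀) :
    ∃ k : ℚ, k ≠ 0 ∧ W'.realPeriodRat = |(k : ℝ)| * W.realPeriodRat ∧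
      (∃ A B : ℚ[X], B.Monic ∧ A.natDegree = B.natDegree + 1 ∧ A.leadingCoeff = k⁻¹ ^ 2 ∧
        ∀ (x y : AlgebraicClosure ℚ)
          (h : (W.baseChange (AlgebraicClosure ℚ)).toAffine.Nonsingular x y),
          ψ (Affine.Point.some x y h) ≠ 0 →
          aeval x B ≠ 0 ∧ ∃ (y₂ : AlgebraicClosure ℚ)
            (h₂ : (W'.baseChange (AlgebraicClosure ℚ)).toAffine.Nonsingular (aeval x A / aeval x B) y₂),
            ψ (Affine.Point.some x y h) = Affine.Point.some (aeval x A / aeval x B) y₂ h₂) ∧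
      (W.IsGloballyMinimal → W'.IsGloballyMinimal → ∃ n : ℤ, (n : ℚ) = k) := by
  have hpP : p.Prime := hp.out
  haveI hWℝ : (W.baseChange ℝ).IsElliptic := by rw [WeierstrassCurve.baseChange]; infer_instance
  haveI hWℝ' : (W'.baseChange ℝ).IsElliptic := by rw [WeierstrassCurve.baseChange]; infer_instance
  obtain ⟨k, hk0, hperiod, hall⟩ := ψ.exists_algebraMap_card_ker_inf_realPoints_mul_realPeriod_eq
  -- Néron-type period pairs and uniformisations
  have hc₄ : (((W.baseChange ℝ).c₄ : ℝ) : ℂ) = (W.baseChange ℂ).c₄ := by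
    rw [WeierstrassCurve.baseChange, WeierstrassCurve.baseChange, map_c₄, map_c₄,
      ofReal_algebraMap_eq]
  have hc₆ : (((W.baseChange ℝ).c₆ : ℝ) : ℂ) = (W.baseChange ℂ).c₆ := by
    rw [WeierstrassCurve.baseChange, WeierstrassCurve.baseChange, map_c₆, map_c₆,
      ofReal_algebraMap_eq]
  have hc₄' : (((W'.baseChange ℝ).c₄ : ℝ) : ℂ) = (W'.baseChange ℂ).c₄ := by
    rw [WeierstrassCurve.baseChange, WeierstrassCurve.baseChange, map_c₄, map_c₄,
      ofReal_algebraMap_eq]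
  have hc₆' : (((W'.baseChange ℝ).c₆ : ℝ) : ℂ) = (W'.baseChange ℂ).c₆ := by
    rw [WeierstrassCurve.baseChange, WeierstrassCurve.baseChange, map_c₆, map_c₆,
      ofReal_algebraMap_eq]
  obtain ⟨L, hL₂, hL₃, -⟩ := (W.baseChange ℝ).exists_periodPair_realPeriod_eq_holds
  obtain ⟨L', hL₂', hL₃', -⟩ := (W'.baseChange ℝ).exists_periodPair_realPeriod_eq_holds
  have h₂ : L.g₂ = (W.baseChange ℂ).c₄ / 12 := by rw [hL₂, ← hc₄]; push_cast; ring
  have h₃ : L.g₃ = (W.baseChange ℂ).c₆ / 216 := by rw [hL₃, ← hc₆]; push_cast; ring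
  have h₂' : L'.g₂ = (W'.baseChange ℂ).c₄ / 12 := by rw [hL₂', ← hc₄']; push_cast; ring
  have h₃' : L'.g₃ = (W'.baseChange ℂ).c₆ / 216 := by rw [hL₃', ← hc₆']; push_cast; ring
  obtain ⟨u, hkeru, hsurj, hu⟩ := L.exists_addMonoidHom_of_g₂_g₃' h₂ h₃
  obtain ⟨u', hkeru', hsurj', hu'⟩ := L'.exists_addMonoidHom_of_g₂_g₃' h₂' h₃'
  obtain ⟨hle, happ, -⟩ := hall h₂ h₃ h₂' h₃' u hkeru hu u' hkeru' hu'
  -- `#ker ψ = p`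
  have hcard : Nat.card ψ.toAddMonoidHom.ker = p := by
    rw [hker]
    have e := Nat.card_congr (Φ₀.equivMapOfInjective (geomTorsion W (p : ℤ)).subtype
      Subtype.val_injective).toEquiv
    rw [← e]; exact hΦ.1
  -- the two archimedean counts
  have hN := natCard_ker_inf_range_eq_one_of_lineOdd hp2 ψ hker hodd
  have hI := relIndex_map_range_eq_one hp2 ψ h₂ h₃ h₂' h₃' hkeru hsurj hu hkeru' hsurj' hu' hk0
    happ hcard
  rw [hN, hI, Nat.cast_one, one_mul, one_mul, eq_ratCast] at hperiod
  refine ⟨k, hk0, hperiod, ?_, fun hmin hmin' ↦ ?_⟩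
  · exact ψ.exists_x_formula_of_baseChange_apply_eq h₂ h₃ h₂' h₃' hsurj hu hkeru' hu' hk0 hle happ
  · haveI := hmin
    haveI := hmin'
    have hle' : ∀ z ∈ L.lattice, (k : ℂ) * z ∈ L'.lattice := fun z hz ↦ by
      rw [← eq_ratCast (algebraMap ℚ ℂ)]; exact hle z hz
    exact integral_neronScaling_of_isGloballyMinimal_holds W W' L L' ⟨h₂, h₃⟩ ⟨h₂', h₃'⟩ k hle'

end Analytic

/-- **`Ω(E') = |k| · Ω(E)` along an isogeny with odd rational `p`-line kernel**, with the
`x`-coordinate formula of multiplier `k` and its integrality for globally minimal models — the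
statement of `exists_multiplier_of_lineOdd_aux` freed from the auxiliary embedding `ℚ̄ → ℂ`
(any `IsAlgClosed.lift`). (Dokchitser–Dokchitser 2015, Thm. 2 at `𝒦 = ℝ`, `p ≠ 2`,
`ker φ ⊄ E(ℝ)`: `Ω(E,ω)/Ω(E',ω') = |ω/φ^*ω'|`; Milne *ADT* I.7.)
[cite: MilneADT2006, Ch. I §7, proof of Thm. 7.3, p. 98] [cite: SilvermanAEC2009, Thm. VI.4.1(b)] -/
theorem exists_multiplier_of_lineOdd {W W' : WeierstrassCurve ℚ} [W.IsElliptic] [W'.IsElliptic]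
    {p : ℕ} [Fact p.Prime] (hp2 : p ≠ 2) (ψ : Isogeny W W')
    {Φ₀ : AddSubgroup (geomTorsion W (p : ℤ))} (hΦ : IsRationalLine W p Φ₀)
    (hker : ψ.toAddMonoidHom.ker = Φ₀.map (geomTorsion W (p : ℤ)).subtype)
    (hodd : LineOdd W p Φ₀) :
    ∃ k : ℚ, k ≠ 0 ∧ W'.realPeriodRat = |(k : ℝ)| * W.realPeriodRat ∧
      (∃ A B : ℚ[X], B.Monic ∧ A.natDegree = B.natDegree + 1 ∧ A.leadingCoeff = k⁻¹ ^ 2 ∧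
        ∀ (x y : AlgebraicClosure ℚ)
          (h : (W.baseChange (AlgebraicClosure ℚ)).toAffine.Nonsingular x y),
          ψ (Affine.Point.some x y h) ≠ 0 →
          aeval x B ≠ 0 ∧ ∃ (y₂ : AlgebraicClosure ℚ)
            (h₂ : (W'.baseChange (AlgebraicClosure ℚ)).toAffine.Nonsingular (aeval x A / aeval x B) y₂),
            ψ (Affine.Point.some x y h) = Affine.Point.some (aeval x A / aeval x B) y₂ h₂) ∧
      (W.IsGloballyMinimal → W'.IsGloballyMinimal → ∃ n : ℤ, (n : ℚ) = k) := by
  haveI hQbar : Algebra.IsAlgebraic ℚ (AlgebraicClosure ℚ) := AlgebraicClosure.isAlgebraic ℚ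
  letI : Algebra (AlgebraicClosure ℚ) ℂ :=
    (IsAlgClosed.lift : AlgebraicClosure ℚ →ₐ[ℚ] ℂ).toRingHom.toAlgebra
  haveI : IsScalarTower ℚ (AlgebraicClosure ℚ) ℂ :=
    IsScalarTower.of_algebraMap_eq' (Subsingleton.elim _ _)
  exact exists_multiplier_of_lineOdd_aux hp2 ψ hΦ hker hodd

end Summit.BirchSwinnertonDyer.Rank1Residual.X2.IsogenyKernelRealPoints

end
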